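import Mathlib
import Summits.ValiantsHypothesis.ValiantsHypothesis.Theses.FreeSubtorus
import Summits.ValiantsHypothesis.ValiantsHypothesis.Theorems.FreeSubtorusSubtorusCovering
import Summits.ValiantsHypothesis.ValiantsHypothesis.Cruxes.OrbitDimensionBound.Lines.ConfusionLadder
import Summits.ValiantsHypothesis.ValiantsHypothesis.Cruxes.OrbitDimensionBound.Lines.RowTorusLadder
import Literature.Computability.AlgebraicComplexity.PBoundedGrowth
import Literature.Computability.AlgebraicComplexity.EquivariantDC

/-!
# Torsion ladder — the SIGN rung above the proved floor `SubtorusCovering`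

Forward generator G1 (`next-rung`, gen 3), unit `fwd2-rung-ValiantsHypothesis-01-g3`, host route
`route-ValiantsHypothesis-FreeSubtorus`, open crux advanced: `OrbitDimensionBound` (stmt-ValiantsHypothesis-16133).

## Q1 FAMILY (one free parameter `N : ℕ`, ordered by divisibility)
`TorsionCovering N`: "for `n ≥ 3`, every affine determinantal representation of `per_n` of size `m` that is equivariant
(exact `GL_m × GL_m` lifts) under the `N`-TORSION SUBGROUP `T_Λ[N]` of the admissibly cut subtorus `T_Λ` (`Λ` with `r`
generators of zero row- and column-sums) has `C(n,⌊n/2⌋) ≤ m · 2^r`".  Here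
`T_Λ[N] = closure {diag(d_k e_l) : d^{Λ_i|rows} e^{Λ_i|cols} = 1 (i < r), d_k^N = 1, e_l^N = 1}` (`torsionSubtorus`).
* FLOOR `N = 0`: `t ^ 0 = 1` makes the torsion conditions vacuous, `T_Λ[0] = T_Λ` (`torsionSubtorus_zero`) and
  `TorsionCovering 0 ↔ SubtorusCovering` (`torsionCovering_zero_iff`, by `simp`; `torsionCovering_zero` is the seed).
* DIAL: `N ∣ N'` gives `T_Λ[N] ≤ T_Λ[N']` (`torsionSubtorus_mono`), hence `TorsionCovering N → TorsionCovering N'`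
  (`TorsionCovering.of_dvd`): fewer symmetries assumed = stronger statement.  Every member implies the floor (`N ∣ 0`).
* SUMMIT END `N = 1`: `T_Λ[1] = ⊥`, so `TorsionCovering 1` is the symmetry-free bound `C(n,⌊n/2⌋) ≤ dc(per_n)` and
  implies `VP ≠ VNP` outright (`vh_of_torsionCovering_one`) — summit-strength, NOT a rung.
* RUNG `N = 2` (this generation): `SignCovering := TorsionCovering 2` — equivariance only under the finite elementary
  abelian 2-group of SIGN CHANGES `x_{kl} ↦ d_k e_l x_{kl}`, `d, e ∈ {±1}ⁿ`, satisfying the `Λ`-relations mod 2.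
  Its asymptotic shadow `SignShadow := TorsionShadow 2` is THE RUNG DECLARATION: implied by the summit
  (`signShadow_of_summit`, one line: `dc(per_n) ≤ m_n ≤ m_n 2^{r_n}`), implying the floor's shadow
  (`floorShadow_of_signShadow`; the floor's shadow is itself a theorem, `RowTorus.powShadow_floor`).

## Q3/Q4 WHY THE FLOOR'S PROOF STOPS HERE
`Theorems/FreeSubtorusSubtorusCovering.lean` (pair sacrifice) reduces to the landed `r = 0` engine `stub_torusBound`
(`BorderApolarityToricWitnessObstructionQPStubTorusBound.lean`): ONE generic torus element of infinite order whose
weights on the `2^n` characters `(1_I ; 1_J)` are pairwise distinct (prime / multiplicatively independent coordinates),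
its per-element exact lift `(g, h)`, and generalised-eigenspace descent; the extension step `stub_torusExtension` takes
`N`-th ROOTS inside the torus.  In `T_Λ[2]` every element has order `2` and eigenvalues `±1` only: a single element
separates nothing, roots do not exist, and the per-element lifts of DIFFERENT elements need not commute — they form a
PROJECTIVE representation of the finite group modulo the stabiliser of `B` (Clifford / Pauli phenomenon).  What replaces
the generic element is the CHARACTER GROUP `𝔽₂^{2n} / span(Λ mod 2)` of the whole finite group, available only after
LINEARISING the lifts (Krull–Schmidt per-summand + Fitting ⇒ Schurian stabiliser; finite supplement of the unipotent
radical; von zur Gathen regularity ⇒ the left kernel LINE of `B(0)` kills the Schur multiplier), and what replaces unique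
factorisation is translation-injectivity of `𝔽₂^{2n}`: a class of level-`t` pairs `(I, J)` modulo `span(Λ mod 2)` has at
most `2^r` members.  Levels are no longer separated (only parity survives mod 2), which is exactly why the bound is the
MIDDLE binomial `C(n,⌊n/2⌋)` (one level) and not `2^n - 1` (all levels) — the floor's statement shape is the sign shape.

## Q5 theorem shape
`SignShadow`, `SignCovering` (the line's numeric hub), `OrbitSignBound` (the RELAXED symmetrisation target: impose only a
finite 2-group of signs, `r ≤ n/2` relations — weaker than `OrbitDimensionBound`, `orbitSignBound_of_orbitDimensionBound`)
with `closes_sign : OrbitSignBound → SignCovering → ValiantsHypothesis` and `closes_rung : OrbitDimensionBound →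
SignCovering → ValiantsHypothesis`.

References: [LandsbergRessayre2017] Thm. 2.8, §6 (torus weights), Question 2.2; Landsberg, *Geometry and Complexity
Theory* (2017) §7.4.1 p. 194 ("I do not know just how large the symmetry group needs to be to obtain an exponential
bound"); [DawarWilsenach2025] ToC 21(14) §7.4 (permutation-symmetric circuits vs. equivariant dc: incomparable);
[Vonzurgathen1987] Thm. 3.1 (regularity); [ChatterjeeKumarVolk2024] Thm. 13 (regular normal form ⇒ ABP);
Borel–Serre 1964 §5 / Platonov (finite supplements in algebraic groups); Glynn 2010 (a sign-symmetric formula of size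
`n 2^{n-1}`, consistent with the rung).
-/

set_option linter.dupNamespace false

noncomputable section

namespace Summit.ValiantsHypothesis.ValiantsHypothesis.Cruxes.OrbitDimensionBound.Torsion

open Literature.Computability.AlgebraicComplexity
open Summit.ValiantsHypothesis.ValiantsHypothesis.Cruxes.OrbitDimensionBound.Confusion
  (Loss CoveringRung CoveringShadow powLoss coveringRung_powLoss coveringRung_powLoss_iff vh_of_middle_bound)
open Summit.ValiantsHypothesis.ValiantsHypothesis.Cruxes.OrbitDimensionBound.RowTorus (powShadow_floor coveringShadow_mono)

/-! ## §1 The subtorus `T_Λ` and its `N`-torsion subgroups `T_Λ[N]` -/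

/-- Generators of the admissibly cut subtorus `T_Λ`: substitutions `x_{kl} ↦ d_k e_l x_{kl}` with
`∏_k d_k^{Λ_i(inl k)} ∏_l e_l^{Λ_i(inr l)} = 1` for all `i` — VERBATIM the generator set of the floor.
[cite: LandsbergRessayre2017, §6] -/
def torusGen (n r : ℕ) (Λ : Fin r → (Fin n ⊕ Fin n) → ℤ) : Set (GL (Fin n × Fin n) ℂ) :=
  {γ : Matrix.GeneralLinearGroup (Fin n × Fin n) ℂ |
    ∃ d e : Fin n → ℂˣ, (∀ i, (∏ k, (d k) ^ (Λ i (Sum.inl k))) * (∏ l, (e l) ^ (Λ i (Sum.inr l))) = 1) ∧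
      (γ : Matrix (Fin n × Fin n) (Fin n × Fin n) ℂ) = Matrix.diagonal (fun p => (d p.1 : ℂ) * (e p.2 : ℂ))}

/-- The subtorus `T_Λ` of the floor (generated subgroup). [cite: LandsbergRessayre2017, §6] -/
def subtorus (n r : ℕ) (Λ : Fin r → (Fin n ⊕ Fin n) → ℤ) : Subgroup (GL (Fin n × Fin n) ℂ) :=
  Subgroup.closure (torusGen n r Λ)

/-- Generators of the `N`-TORSION subgroup `T_Λ[N]`: as `torusGen`, with `d_k^N = 1` and `e_l^N = 1` in addition
(`N = 0`: no condition; `N = 2`: sign changes). [cite: LandsbergRessayre2017, §6] -/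
def torsionGen (n r : ℕ) (Λ : Fin r → (Fin n ⊕ Fin n) → ℤ) (N : ℕ) : Set (GL (Fin n × Fin n) ℂ) :=
  {γ : Matrix.GeneralLinearGroup (Fin n × Fin n) ℂ |
    ∃ d e : Fin n → ℂˣ, (∀ i, (∏ k, (d k) ^ (Λ i (Sum.inl k))) * (∏ l, (e l) ^ (Λ i (Sum.inr l))) = 1) ∧
      (∀ k, d k ^ N = 1) ∧ (∀ l, e l ^ N = 1) ∧
      (γ : Matrix (Fin n × Fin n) (Fin n × Fin n) ℂ) = Matrix.diagonal (fun p => (d p.1 : ℂ) * (e p.2 : ℂ))}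

/-- **`T_Λ[N]`**, the subgroup generated by the `N`-torsion generators. [cite: LandsbergRessayre2017, §6] -/
def torsionSubtorus (n r : ℕ) (Λ : Fin r → (Fin n ⊕ Fin n) → ℤ) (N : ℕ) : Subgroup (GL (Fin n × Fin n) ℂ) :=
  Subgroup.closure (torsionGen n r Λ N)

/-- `N = 0`: the torsion conditions `t ^ 0 = 1` are vacuous — the generator sets coincide. [folklore] -/
theorem torsionGen_zero (n r : ℕ) (Λ : Fin r → (Fin n ⊕ Fin n) → ℤ) : torsionGen n r Λ 0 = torusGen n r Λ := by
  ext γ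
  simp [torsionGen, torusGen]

/-- `T_Λ[0] = T_Λ`. [folklore] -/
theorem torsionSubtorus_zero (n r : ℕ) (Λ : Fin r → (Fin n ⊕ Fin n) → ℤ) :
    torsionSubtorus n r Λ 0 = subtorus n r Λ := by
  rw [torsionSubtorus, torsionGen_zero, subtorus]

/-- The torsion generators are torus generators. [folklore] -/
theorem torsionGen_subset (n r : ℕ) (Λ : Fin r → (Fin n ⊕ Fin n) → ℤ) (N : ℕ) :
    torsionGen n r Λ N ⊆ torusGen n r Λ := by
  rintro γ ⟨d, e, hrel, -, -, hγ⟩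
  exact ⟨d, e, hrel, hγ⟩

/-- `T_Λ[N] ≤ T_Λ`. [folklore] -/
theorem torsionSubtorus_le (n r : ℕ) (Λ : Fin r → (Fin n ⊕ Fin n) → ℤ) (N : ℕ) :
    torsionSubtorus n r Λ N ≤ subtorus n r Λ :=
  Subgroup.closure_mono (torsionGen_subset n r Λ N)

/-- DIAL: `N ∣ N'` gives `T_Λ[N] ≤ T_Λ[N']`. [folklore] -/
theorem torsionSubtorus_mono (n r : ℕ) (Λ : Fin r → (Fin n ⊕ Fin n) → ℤ) {N N' : ℕ} (h : N ∣ N') :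
    torsionSubtorus n r Λ N ≤ torsionSubtorus n r Λ N' := by
  refine Subgroup.closure_mono ?_
  rintro γ ⟨d, e, hrel, hd, he, hγ⟩
  obtain ⟨c, rfl⟩ := h
  exact ⟨d, e, hrel, fun k => by rw [pow_mul, hd k, one_pow], fun l => by rw [pow_mul, he l, one_pow], hγ⟩

/-- SUMMIT END of the dial: `T_Λ[1]` is trivial. [folklore] -/
theorem torsionSubtorus_one (n r : ℕ) (Λ : Fin r → (Fin n ⊕ Fin n) → ℤ) : torsionSubtorus n r Λ 1 = ⊥ := by
  rw [torsionSubtorus, Subgroup.closure_eq_bot_iff]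
  rintro γ ⟨d, e, -, hd, he, hγ⟩
  simp only [pow_one] at hd he
  have h1 : (γ : Matrix (Fin n × Fin n) (Fin n × Fin n) ℂ) = 1 := by
    rw [hγ]; simp [hd, he]
  exact Units.ext h1

/-! ## §2 The family `TorsionCovering N`, the floor `N = 0`, the rung `N = 2` -/

/-- **The graded family `TorsionCovering N`** — the floor `Theses.FreeSubtorus.SubtorusCovering` VERBATIM with the
symmetry group `T_Λ` replaced by its `N`-torsion subgroup `T_Λ[N]`. [cite: LandsbergRessayre2017, Thm. 2.8, §6] -/
def TorsionCovering (N : ℕ) : Prop :=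
  ∀ n : ℕ, 3 ≤ n → ∀ (m r : ℕ) (Λ : Fin r → (Fin n ⊕ Fin n) → ℤ)
    (B : Matrix (Fin m) (Fin m) (MvPolynomial (Fin n × Fin n) ℂ)),
    (∀ i, (∑ k, Λ i (Sum.inl k)) = 0 ∧ (∑ l, Λ i (Sum.inr l)) = 0) →
    IsEquivariantDetRepr (torsionSubtorus n r Λ N) (perPoly (Fin n) ℂ) B →
    Nat.choose n (n / 2) ≤ m * 2 ^ r

/-- **THE RUNG's numeric member `SignCovering := TorsionCovering 2`**: for `n ≥ 3`, an affine determinantal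
representation of `per_n` of size `m`, equivariant (exact lifts) under the SIGN group `T_Λ[2]` (`Λ` admissible, `r`
generators), has `C(n,⌊n/2⌋) ≤ m · 2^r`. [cite: LandsbergRessayre2017, Question 2.2, §6] -/
def SignCovering : Prop := TorsionCovering 2

/-- The member `N = 0` IS the floor, literally (`t ^ 0 = 1`). [folklore] -/
theorem torsionCovering_zero_iff :
    TorsionCovering 0 ↔ Summit.ValiantsHypothesis.ValiantsHypothesis.Theses.FreeSubtorus.SubtorusCovering := by
  simp only [TorsionCovering, torsionSubtorus_zero]
  rfl

/-- **The floor is proved**: `TorsionCovering 0` (seed g1-ValiantsHypothesis-16134). [cite: LandsbergRessayre2017, Thm. 2.8] -/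
theorem torsionCovering_zero : TorsionCovering 0 :=
  torsionCovering_zero_iff.2
    Summit.ValiantsHypothesis.ValiantsHypothesis.Theorems.FreeSubtorusSubtorusCovering.subtorusCovering_proof

/-- DIAL monotonicity (harder-to-easier): `N ∣ N'` gives `TorsionCovering N → TorsionCovering N'` (a representation
equivariant under the bigger group `T_Λ[N']` is equivariant under `T_Λ[N]`). [folklore] -/
theorem TorsionCovering.of_dvd {N N' : ℕ} (hd : N ∣ N') (h : TorsionCovering N) : TorsionCovering N' :=
  fun n hn m r Λ B hΛ hB => h n hn m r Λ B hΛ (hB.anti (torsionSubtorus_mono n r Λ hd))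

/-- Every member implies the floor (`N ∣ 0`). [folklore] -/
theorem subtorusCovering_of_torsionCovering {N : ℕ} (h : TorsionCovering N) :
    Summit.ValiantsHypothesis.ValiantsHypothesis.Theses.FreeSubtorus.SubtorusCovering :=
  torsionCovering_zero_iff.1 (h.of_dvd (dvd_zero N))

/-- rung ⇒ floor (numeric). [folklore] -/
theorem subtorusCovering_of_signCovering (h : SignCovering) :
    Summit.ValiantsHypothesis.ValiantsHypothesis.Theses.FreeSubtorus.SubtorusCovering :=
  subtorusCovering_of_torsionCovering h

/-- SUMMIT END: `TorsionCovering 1` is the symmetry-free bound `C(n,⌊n/2⌋) ≤ m` for EVERY affine determinantal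
representation of `per_n`, `n ≥ 3`. [folklore] -/
theorem bound_of_torsionCovering_one (h : TorsionCovering 1) (n : ℕ) (hn : 3 ≤ n) (m : ℕ)
    (A : Matrix (Fin m) (Fin m) (MvPolynomial (Fin n × Fin n) ℂ)) (hA : IsAffineDetRepr (perPoly (Fin n) ℂ) A) :
    Nat.choose n (n / 2) ≤ m := by
  have hA' : IsEquivariantDetRepr (torsionSubtorus n 0 (fun i => i.elim0) 1) (perPoly (Fin n) ℂ) A := by
    rw [torsionSubtorus_one]
    exact isEquivariantDetRepr_bot_iff.2 hA
  simpa using h n hn m 0 (fun i => i.elim0) A (fun i => i.elim0) hA'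

/-- … hence `TorsionCovering 1 → VP ≠ VNP` (summit-strength: this is why the rung is `N = 2`, not `N = 1`).
[cite: BurgisserClausenShokrollahi1997, Cor. (21.40)] -/
theorem vh_of_torsionCovering_one (h : TorsionCovering 1) : _root_.ValiantsHypothesis := by
  refine vh_of_middle_bound fun n hn => ?_
  obtain ⟨A, hA⟩ := hasDetRepr_determinantalComplexity_holds (perPoly (Fin n) ℂ)
  exact (bound_of_torsionCovering_one h n hn _ A hA).trans (Nat.le_mul_of_pos_right _ (by positivity))

/-! ## §3 The asymptotic shadow `TorsionShadow N`; the rung declaration `SignShadow`; ON-PATH `S → SignShadow` -/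

/-- **Asymptotic shadow of `TorsionCovering N`.**  Along ANY sequence `(Λ_n, B_n)` of admissible lattice data and
`T_{Λ_n}[N]`-equivariant affine determinantal representations `B_n` of `per_n` (sizes `m_n`, `n ≥ 3`), the function
`n ↦ m_n · 2^{r_n}` is not p-bounded. [cite: LandsbergRessayre2017, Question 2.2] -/
def TorsionShadow (N : ℕ) : Prop :=
  ∀ (m r : ℕ → ℕ) (Λ : (n : ℕ) → Fin (r n) → (Fin n ⊕ Fin n) → ℤ)
    (B : (n : ℕ) → Matrix (Fin (m n)) (Fin (m n)) (MvPolynomial (Fin n × Fin n) ℂ)),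
    (∀ n : ℕ, 3 ≤ n →
      (∀ i, (∑ k, Λ n i (Sum.inl k)) = 0 ∧ (∑ l, Λ n i (Sum.inr l)) = 0) ∧
      IsEquivariantDetRepr (torsionSubtorus n (r n) (Λ n) N) (perPoly (Fin n) ℂ) (B n)) →
    ¬ IsPBounded (fun n => m n * 2 ^ (r n))

/-- **THE RUNG DECLARATION `SignShadow := TorsionShadow 2`.** [cite: LandsbergRessayre2017, Question 2.2] -/
def SignShadow : Prop := TorsionShadow 2

/-- The floor's shadow in torsion clothing: `TorsionShadow 0 ↔ CoveringShadow 2^r`. [folklore] -/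
theorem torsionShadow_zero_iff : TorsionShadow 0 ↔ CoveringShadow powLoss := by
  simp only [TorsionShadow, torsionSubtorus_zero]
  rfl

/-- A numeric member implies its shadow (middle binomial not p-bounded, `not_isPBounded_choose_middle`). [folklore] -/
theorem torsionShadow_of_torsionCovering {N : ℕ} (h : TorsionCovering N) : TorsionShadow N := by
  intro m r Λ B hyp hPB
  exact not_isPBounded_choose_middle
    (IsPBounded.of_eventually_le 3 hPB fun n hn => h n hn (m n) (r n) (Λ n) (B n) (hyp n hn).1 (hyp n hn).2)

/-- rung numeric ⇒ RUNG. [folklore] -/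
theorem signShadow_of_signCovering (h : SignCovering) : SignShadow :=
  torsionShadow_of_torsionCovering h

/-- Shadows are antitone along the dial: `N ∣ N'` gives `TorsionShadow N → TorsionShadow N'`. [folklore] -/
theorem TorsionShadow.of_dvd {N N' : ℕ} (hd : N ∣ N') (h : TorsionShadow N) : TorsionShadow N' :=
  fun m r Λ B hyp => h m r Λ B fun n hn =>
    ⟨(hyp n hn).1, (hyp n hn).2.anti (torsionSubtorus_mono n (r n) (Λ n) hd)⟩

/-- RUNG ⇒ floor's shadow (`2 ∣ 0`); the floor's shadow is a theorem (`RowTorus.powShadow_floor`). [folklore] -/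
theorem floorShadow_of_signShadow (h : SignShadow) : CoveringShadow powLoss :=
  torsionShadow_zero_iff.1 (h.of_dvd (dvd_zero 2))

/-- The floor's shadow, restated: `TorsionShadow 0` holds. [cite: LandsbergRessayre2017, Thm. 2.8] -/
theorem torsionShadow_zero : TorsionShadow 0 :=
  torsionShadow_of_torsionCovering torsionCovering_zero

/-- **ON-PATH LEMMA `S → TorsionShadow N`** for every `N`: `dc(per_n) ≤ m_n ≤ m_n 2^{r_n}`; a p-bounded `dc(per)`
makes `per` a `VP` family (`isVPFamily_of_isPBounded_determinantalComplexity`), hence `VP = VNP`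
(`perFamily_mem_VP_iff_VP_eq_VNP`, char `ℂ ≠ 2`). [cite: Burgisser2000, Thm. 2.10, §2.5] [cite: Valiant1979] -/
theorem torsionShadow_of_summit (N : ℕ) (hS : _root_.ValiantsHypothesis) : TorsionShadow N := by
  intro m r Λ B hyp hPB
  have hdc : IsPBounded (fun n => determinantalComplexity (perPoly (Fin n) ℂ)) := by
    refine IsPBounded.of_eventually_le 3 hPB fun n hn => ?_
    have hrep : HasDetRepr (perPoly (Fin n) ℂ) (m n) := ⟨B n, (hyp n hn).2.1⟩
    calc determinantalComplexity (perPoly (Fin n) ℂ) ≤ m n := determinantalComplexity_le_of_hasDetRepr hrep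
      _ ≤ m n * 2 ^ (r n) := Nat.le_mul_of_pos_right _ (by positivity)
  have hι : IsPBounded (fun n => Fintype.card (Fin n × Fin n)) :=
    (IsPBounded.mul_holds IsPBounded.id IsPBounded.id).mono fun n => by simp
  have hVP : IsVPFamily (fun n => perPoly (Fin n) ℂ) :=
    Summit.ValiantsHypothesis.Theorems.DeterminantalRigidityReductions.isVPFamily_of_isPBounded_determinantalComplexity
      hι hdc
  have hmem : perFamily ℂ ∈ VP ℂ := (mem_VP_ofFintype_iff_holds (fun n => perPoly (Fin n) ℂ)).2 hVP
  exact hS ((perFamily_mem_VP_iff_VP_eq_VNP ℂ ringChar_complex_ne_two).1 hmem)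

/-- **ON PATH: `S → SignShadow`** (the rung is a consequence of the summit). [cite: LandsbergRessayre2017, Question 2.2] -/
@[aesop safe apply]
theorem signShadow_of_summit (hS : _root_.ValiantsHypothesis) : SignShadow :=
  torsionShadow_of_summit 2 hS

/-! ## §4 The relaxed symmetrisation target and the closings -/

/-- **`OrbitTorsionBound N`** — crux #1 RELAXED by the rung: for `n ≥ 3`, every affine determinantal representation `A`
of `per_n` of size `m` can be replaced by one, `B`, of the same size that is equivariant (exact lifts) under the
`N`-torsion subgroup `T_Λ[N]` of SOME admissibly cut subtorus with `r ≤ n/2` generators.  At `N = 2` only a finite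
elementary abelian 2-group of sign changes has to be imposed. [cite: LandsbergRessayre2017, Question 2.2] -/
def OrbitTorsionBound (N : ℕ) : Prop :=
  ∀ n : ℕ, 3 ≤ n → ∀ (m : ℕ) (A : Matrix (Fin m) (Fin m) (MvPolynomial (Fin n × Fin n) ℂ)),
    IsAffineDetRepr (perPoly (Fin n) ℂ) A →
    ∃ (B : Matrix (Fin m) (Fin m) (MvPolynomial (Fin n × Fin n) ℂ)) (r : ℕ) (Λ : Fin r → (Fin n ⊕ Fin n) → ℤ),
      r ≤ n / 2 ∧ (∀ i, (∑ k, Λ i (Sum.inl k)) = 0 ∧ (∑ l, Λ i (Sum.inr l)) = 0) ∧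
      IsEquivariantDetRepr (torsionSubtorus n r Λ N) (perPoly (Fin n) ℂ) B

/-- **`OrbitSignBound := OrbitTorsionBound 2`**: symmetrise an optimal expression of `per_n` under a finite 2-group of
sign changes only. [cite: LandsbergRessayre2017, Question 2.2] -/
def OrbitSignBound : Prop := OrbitTorsionBound 2

/-- `OrbitDimensionBound → OrbitTorsionBound N` (`T_Λ[N] ≤ T_Λ`). [cite: LandsbergRessayre2017, Question 2.2] -/
theorem orbitTorsionBound_of_orbitDimensionBound (N : ℕ)
    (h : Summit.ValiantsHypothesis.ValiantsHypothesis.Theses.FreeSubtorus.OrbitDimensionBound) :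
    OrbitTorsionBound N := by
  intro n hn m A hA
  obtain ⟨B, r, Λ, hr, hΛ, hB⟩ := h n hn m A hA
  exact ⟨B, r, Λ, hr, hΛ, hB.anti (torsionSubtorus_le n r Λ N)⟩

/-- In particular `OrbitDimensionBound → OrbitSignBound`. [cite: LandsbergRessayre2017, Question 2.2] -/
theorem orbitSignBound_of_orbitDimensionBound
    (h : Summit.ValiantsHypothesis.ValiantsHypothesis.Theses.FreeSubtorus.OrbitDimensionBound) : OrbitSignBound :=
  orbitTorsionBound_of_orbitDimensionBound 2 h

/-- **The relaxed closing `OrbitTorsionBound N → TorsionCovering N → VP ≠ VNP`**: re-realise an optimal expression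
(`hasDetRepr_determinantalComplexity_holds`) `T_Λ[N]`-equivariantly at size `dc(per_n)` with `r ≤ n/2`; the member gives
`C(n,⌊n/2⌋) ≤ dc(per_n) 2^r ≤ dc(per_n) 2^{⌊n/2⌋}`; `vh_of_middle_bound` (the host route's arithmetic) concludes.
[cite: LandsbergRessayre2017, Thm. 2.8, Question 2.2] [cite: BurgisserClausenShokrollahi1997, Cor. (21.40)] -/
theorem closes_torsion (N : ℕ) (h₁ : OrbitTorsionBound N) (h₂ : TorsionCovering N) : _root_.ValiantsHypothesis := by
  refine vh_of_middle_bound fun n hn => ?_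
  obtain ⟨A, hA⟩ := hasDetRepr_determinantalComplexity_holds (perPoly (Fin n) ℂ)
  obtain ⟨B, r, Λ, hr, hΛ, hB⟩ := h₁ n hn _ A hA
  exact (h₂ n hn _ r Λ B hΛ hB).trans (Nat.mul_le_mul_left _ (Nat.pow_le_pow_right (by norm_num) hr))

/-- **`closes_sign : OrbitSignBound → SignCovering → VP ≠ VNP`** — the host route's `closes` with crux #2 strengthened to
the rung's numeric member and crux #1 relaxed to finite sign symmetry. [cite: LandsbergRessayre2017, Question 2.2] -/
theorem closes_sign (h₁ : OrbitSignBound) (h₂ : SignCovering) : _root_.ValiantsHypothesis :=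
  closes_torsion 2 h₁ h₂

/-- The rung's numeric member closes with the ORIGINAL crux as well: `OrbitDimensionBound → SignCovering → VH` (through
the host's own `closes`, since the member implies the floor). [cite: LandsbergRessayre2017, Thm. 2.8] -/
theorem closes_rung (h₁ : Summit.ValiantsHypothesis.ValiantsHypothesis.Theses.FreeSubtorus.OrbitDimensionBound)
    (h₂ : SignCovering) : _root_.ValiantsHypothesis :=
  Summit.ValiantsHypothesis.ValiantsHypothesis.Theses.FreeSubtorus.closes h₁ (subtorusCovering_of_signCovering h₂)

/-- For the record, the host's closing from the floor alone (floor proved): `OrbitDimensionBound → VH`.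
[cite: LandsbergRessayre2017, Thm. 2.8] -/
theorem closes_floor (h₁ : Summit.ValiantsHypothesis.ValiantsHypothesis.Theses.FreeSubtorus.OrbitDimensionBound) :
    _root_.ValiantsHypothesis :=
  Summit.ValiantsHypothesis.ValiantsHypothesis.Theses.FreeSubtorus.closes h₁ (torsionCovering_zero_iff.1 torsionCovering_zero)

end Summit.ValiantsHypothesis.ValiantsHypothesis.Cruxes.OrbitDimensionBound.Torsion

end
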